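import Summits.ABC.StewartYu.PadicG3ParN
import Summits.ABC.StewartYu.PadicG3ParVG
import HarnessLib

/-!
# The `𝔑`-threaded `p`-adic Gen-3 record `PadicG3ParN` — the `Y₀`-degree and depth ATOMS in `Zp` units

Support file (definitions of the `N`-allowances and elementary theorems; no named facts). Cell `abc-stewartyu`,
route `YuMatveevShapeRat`, crux `PadicCoreOddRat` (stmt-ABC-20503); seat p1 (record owner). Continues
`PadicG3ParN`; these are the `N`-twins of the v2 atoms the `schedVb` pack consumed (`L0V_le`, `L0V_mul_yloadG_le`,
`L0V_le_Zp`, `AVV_le`, `AVp_le`, `lunkV_le`, `CondFloorV_le`), in the same currency `Zp = G·(g·XV·LgV)`: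

* `yloadN ≤ N·yloadG` (the extra depth `(ŜN−ŜG)·log 2 ≤ (⌊log₂N⌋+1)·log 2` is `≤ (N−1)·yloadG`);
* **`L₀N ≤ Zp/(4N·yloadG) + 1`**, hence **`L₀N·yloadN ≤ Zp/4 + yloadN`** — the SAME quarter of `Zp` as v2's
  `L0V_mul_yloadG_le`, although the true load `yloadN` exceeds `yloadG`: the division of the degree by `N` pays;
  `L₀N ≤ Zp/(64N) + 1`; `AVN = L₀N·(ŜN+n+5)·log 2 ≤ Zp/4 + yloadN`, `AVN⁺ = L₀N·(ŜN+n+6)·log 2 ≤ (27/100)Zp + yloadN + 1`;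
* `lunkN = log(L₀N+1) + log N + n·log(2LV) ≤ Zp/32 + 1 + W` (the unknown count over `𝔑`, `log N ≤ W`);
* `(ŜN : ℝ)·log 2 ≤ ŜG·log 2 + W + log 2` (under `N_q = K`); `yloadN ≤ yloadG + W + log 2`;
* `CondFloorN ν = 2^{ν+1}·2^{ŜN}·g·XV·(log p/(p−1)) ≤ 2^{ν+n+27}·K·N·g²·XV·(log p/(p−1))`.

## References
* [Nesterenko2003] Yu. V. Nesterenko, LNM 1819 (2003) — §3.5 (3.23)–(3.24), (3.37)–(3.39), §4.2 (4.30).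
* [Yu2013] K. Yu, Acta Math. 211 (2013) — §3.1.
-/

noncomputable section

open Finset Real

namespace Summit.ABC.StewartYu

namespace PadicG3ParN

open PadicG3Par (Cb cM cG)

variable {n : ℕ} (P : PadicG3ParN n)

/-! ### The `N`-allowances -/

/-- `AVN = L₀N·(ŜN + n + 5)·log 2` (the `Y₀`-weights at the true depth). [cite: Nesterenko2003, (3.39)] -/
def AVN : ℝ := P.L0N * ((P.SdN + n + 5) * Real.log 2)

/-- `lunkN = log(L₀N + 1) + log N + n·log(2 LV)` (logarithm of the unknown count over `𝔑`). [folklore] -/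
def lunkN : ℝ := Real.log (P.L0N + 1) + Real.log P.N + n * Real.log (2 * P.LV)

/-- the floor-phase range term at the true depth `CondFloorN ν = 2^{ν+1}·2^{ŜN}·g·XV·(log p/(p−1))`. [folklore] -/
def CondFloorN (ν : ℕ) : ℝ := 2 ^ (ν + 1) * 2 ^ P.SdN * P.g * P.XV * (Real.log P.p / (P.p - 1))

/-! ### The true load against `N` -/

/-- **`yloadN ≤ N · yloadG`** under `N_q = K`. [folklore] -/
theorem yloadN_le_N_mul_yloadG (hNq : P.Nq = P.K) : P.yloadN ≤ P.N * P.yloadG := by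
  have hY := P.yloadG_pos
  have hG : 16 ≤ P.yloadG := le_trans P.sixteen_le_G P.G_le_yloadG
  by_cases h1 : P.N = 1
  · -- `N = 1`: `ŜN = ŜG`
    have hS : P.SdN = P.SdG := by
      unfold SdN PadicG3Par.SdG; rw [hNq, h1, mul_one]
    have e : P.yloadN = P.yloadG := by unfold yloadN PadicG3Par.yloadG; rw [hS]
    rw [e, h1]; simp
  · have hN2 : (2 : ℝ) ≤ P.N := by have := P.hN; exact_mod_cast (show 2 ≤ P.N by omega)
    have h := P.yloadN_le hNq
    have hlog : (Nat.log 2 P.N : ℝ) * Real.log 2 ≤ P.N := by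
      have h2 : (2 : ℝ) ^ Nat.log 2 P.N ≤ P.N := by
        exact_mod_cast Nat.pow_log_le_self 2 (by have := P.hN; omega)
      have h3 : (Nat.log 2 P.N : ℝ) * Real.log 2 = Real.log ((2 : ℝ) ^ Nat.log 2 P.N) := by
        rw [Real.log_pow]
      rw [h3]
      have h4 := Real.log_le_log (by positivity) h2
      have h5 : Real.log (P.N : ℝ) ≤ P.N := (Real.log_le_sub_one_of_pos P.N_pos).trans (by linarith)
      linarith
    have hl2 : Real.log 2 < 1 := by have := Real.log_two_lt_d9; linarith
    nlinarith

/-- `yloadN ≤ yloadG + W + log 2` under `N_q = K` (the extra depth in the coefficient logarithm). [folklore] -/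
theorem yloadN_le_W (hNq : P.Nq = P.K) : P.yloadN ≤ P.yloadG + P.W + Real.log 2 := by
  have h := P.yloadN_le hNq
  have hW := P.natlog_N_mul_log_two_le_W
  nlinarith

/-- `(ŜN : ℝ)·log 2 ≤ ŜG·log 2 + W + log 2` under `N_q = K`. [folklore] -/
theorem SdN_log_le_W (hNq : P.Nq = P.K) : (P.SdN : ℝ) * Real.log 2 ≤ P.SdG * Real.log 2 + P.W + Real.log 2 := by
  have h : (P.SdN : ℝ) ≤ P.SdG + Nat.log 2 P.N + 1 := by exact_mod_cast P.SdN_le hNq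
  have hW := P.natlog_N_mul_log_two_le_W
  have hl : 0 < Real.log 2 := Real.log_pos one_lt_two
  nlinarith

/-! ### The `Y₀`-degree in `Zp` units -/

/-- **`L₀N ≤ Zp/(4 N yloadG) + 1`** (`Zp = G·(g·XV·LgV)`). [folklore] -/
theorem L0N_le' : (P.L0N : ℝ) ≤ P.Zp / (4 * P.N * P.yloadG) + 1 := by
  have h1 := P.L0N_lt
  have h2 := P.coreV_le
  have hY := P.yloadG_pos
  have hN := P.N_pos
  have hX : (0 : ℝ) ≤ P.XV := by positivity
  have hg0 : 0 < P.g := lt_of_lt_of_le one_pos P.one_le_g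
  have hg : 0 < P.g ^ n := pow_pos hg0 n
  have hgn : 0 < P.g ^ (n - 1) := pow_pos hg0 _
  have e : 6 * (P.XV : ℝ) * Cb ^ n * P.Ω * P.K / (P.g ^ (n - 1) * P.N) =
      6 * P.g * P.XV * (Cb ^ n * P.Ω * P.K / P.g ^ n) / P.N := by
    rw [P.pow_g_eq]; field_simp
  have h3 : 6 * (P.XV : ℝ) * Cb ^ n * P.Ω * P.K / (P.g ^ (n - 1) * P.N) ≤ P.Zp / (4 * P.N * P.yloadG) := by
    rw [e, div_le_iff₀ hN]
    have hgX : 0 ≤ 6 * P.g * P.XV := by positivity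
    have := mul_le_mul_of_nonneg_left h2 hgX
    have e2 : 6 * P.g * P.XV * (P.LgV * P.G / (24 * P.yloadG)) = P.Zp / (4 * P.N * P.yloadG) * P.N := by
      unfold PadicG3Par.Zp; field_simp; ring
    linarith [e2.le, e2.ge]
  linarith

/-- **`L₀N · yloadN ≤ Zp/4 + yloadN`** under `N_q = K` — the same quarter of `Zp` as v2. [folklore] -/
theorem L0N_mul_yloadN_le (hNq : P.Nq = P.K) : P.L0N * P.yloadN ≤ P.Zp / 4 + P.yloadN := by
  have h := P.L0N_le'
  have hYN := P.yloadN_le_N_mul_yloadG hNq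
  have hY := P.yloadG_pos
  have hN := P.N_pos
  have hZ := P.Zp_facts.1
  have hYN0 : 0 ≤ P.yloadN := le_trans hY.le (P.yloadG_le_yloadN hNq)
  have h1 := mul_le_mul_of_nonneg_right h hYN0
  have h2 : P.Zp / (4 * P.N * P.yloadG) * P.yloadN ≤ P.Zp / 4 := by
    rw [div_mul_eq_mul_div, div_le_div_iff₀ (by positivity) (by norm_num)]
    nlinarith
  nlinarith

/-- `L₀N ≤ Zp/(64 N) + 1` (`yloadG ≥ 16`). [folklore] -/
theorem L0N_le_Zp : (P.L0N : ℝ) ≤ P.Zp / (64 * P.N) + 1 := by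
  have h := P.L0N_le'
  have hY16 : (16 : ℝ) ≤ P.yloadG := le_trans P.sixteen_le_G P.G_le_yloadG
  have hZ := P.Zp_facts.1
  have hN := P.N_pos
  have h1 : P.Zp / (4 * P.N * P.yloadG) ≤ P.Zp / (64 * P.N) := by
    refine div_le_div_of_nonneg_left hZ.le (by positivity) ?_
    nlinarith
  linarith

/-- `L₀N ≤ Zp/64 + 1`. [folklore] -/
theorem L0N_le_Zp' : (P.L0N : ℝ) ≤ P.Zp / 64 + 1 := by
  have h := P.L0N_le_Zp
  have hZ := P.Zp_facts.1
  have hN := P.one_le_N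
  have h1 : P.Zp / (64 * P.N) ≤ P.Zp / 64 :=
    div_le_div_of_nonneg_left hZ.le (by norm_num) (by nlinarith)
  linarith

/-- **`AVN ≤ Zp/4 + yloadN`** under `N_q = K` (`(ŜN+n+5)·log 2 ≤ yloadN`). [cite: Nesterenko2003, (3.39)] -/
theorem AVN_le (hNq : P.Nq = P.K) : P.AVN ≤ P.Zp / 4 + P.yloadN := by
  have h := P.L0N_mul_yloadN_le hNq
  have hc : ((P.SdN : ℝ) + n + 5) * Real.log 2 ≤ P.yloadN := by
    unfold yloadN
    have hl : Real.log 2 < 1 := by have := Real.log_two_lt_d9; linarith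
    have hl0 : 0 < Real.log 2 := Real.log_pos one_lt_two
    have hG : 8 ≤ P.G := P.eight_le_G
    have hlp : 0 ≤ Real.log (P.p : ℝ) := P.log_p_pos.le
    have hln : 0 ≤ Real.log ((n : ℝ) + 1) := Real.log_nonneg (by have : (0:ℝ) ≤ n := Nat.cast_nonneg n; linarith)
    nlinarith
  have hL0 : (0 : ℝ) ≤ P.L0N := by positivity
  unfold AVN
  nlinarith [mul_le_mul_of_nonneg_left hc hL0]

/-- `AVN⁺ = L₀N·(ŜN+n+6)·log 2 ≤ (27/100)·Zp + yloadN + 1` under `N_q = K`. [folklore] -/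
theorem AVpN_le (hNq : P.Nq = P.K) :
    (P.L0N : ℝ) * ((P.SdN + n + 6) * Real.log 2) ≤ (27 / 100) * P.Zp + P.yloadN + 1 := by
  have h1 := P.AVN_le hNq
  have h2 := P.L0N_le_Zp'
  unfold AVN at h1
  have hl2 : Real.log 2 < 0.6931471808 := Real.log_two_lt_d9
  have hl20 : 0 < Real.log 2 := Real.log_pos (by norm_num)
  have hL0 : (0 : ℝ) ≤ P.L0N := by positivity
  have : (P.L0N : ℝ) * ((P.SdN + n + 6) * Real.log 2) = P.L0N * ((P.SdN + n + 5) * Real.log 2) + P.L0N * Real.log 2 := by ring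
  rw [this]
  have hZ := P.Zp_facts.1
  have h3 : (P.L0N : ℝ) * Real.log 2 ≤ (P.Zp / 64 + 1) * Real.log 2 := mul_le_mul_of_nonneg_right h2 hl20.le
  have h4 : (P.Zp / 64 + 1) * Real.log 2 ≤ (P.Zp / 64 + 1) * 0.6931471808 := mul_le_mul_of_nonneg_left hl2.le (by positivity)
  linarith

/-- **`lunkN ≤ Zp/32 + 1 + W`** (`log(L₀N+1) ≤ log(L₀V+1)`, `log N ≤ W`, and v2's `lunkV ≤ Zp/32 + 1`). [folklore] -/
theorem lunkN_le : P.lunkN ≤ P.Zp / 32 + 1 + P.W := by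
  have h := P.lunkV_le
  have hW := P.hNW
  have hL : Real.log ((P.L0N : ℝ) + 1) ≤ Real.log ((P.L0V : ℝ) + 1) := by
    refine Real.log_le_log (by positivity) ?_
    exact_mod_cast Nat.add_le_add_right P.L0N_le_L0V 1
  unfold lunkN
  unfold PadicG3Par.lunkV at h
  linarith

/-! ### The floor-phase range term -/

/-- **`CondFloorN ν ≤ 2^{ν+n+27} · K · N · g² · XV · (log p/(p−1))`**. [folklore] -/
theorem CondFloorN_le (ν : ℕ) :
    P.CondFloorN ν ≤ 2 ^ (ν + n + 27) * (P.K * P.N) * P.g ^ 2 * P.XV * (Real.log P.p / (P.p - 1)) := by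
  unfold CondFloorN
  have h : (2 : ℝ) ^ P.SdN ≤ 2 ^ (n + 24) * (P.K * P.N) * 2 ^ P.lgg := by exact_mod_cast P.two_pow_SdN_le
  obtain ⟨_, hκ0⟩ := P.kappa_le_one
  have hg1 := P.one_le_g
  have hg : 0 ≤ P.g := by linarith
  have hlg : (2 : ℝ) ^ P.lgg < 4 * P.g := P.two_pow_lgg_lt
  have hX : (0 : ℝ) ≤ P.XV := by positivity
  have hKN : (0 : ℝ) ≤ P.K * P.N := by have := P.K_pos; have := P.N_pos; positivity
  have h0 : 0 ≤ (2 : ℝ) ^ (ν + 1) * P.g * P.XV * (Real.log P.p / (P.p - 1)) := by positivity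
  have h2 : (2 : ℝ) ^ P.SdN ≤ 2 ^ (n + 26) * (P.K * P.N) * P.g := by
    have h3 : (2 : ℝ) ^ (n + 24) * (P.K * P.N) * 2 ^ P.lgg ≤ 2 ^ (n + 24) * (P.K * P.N) * (4 * P.g) :=
      mul_le_mul_of_nonneg_left hlg.le (by positivity)
    have e : (2 : ℝ) ^ (n + 24) * (P.K * P.N) * (4 * P.g) = 2 ^ (n + 26) * (P.K * P.N) * P.g := by
      rw [show n + 26 = (n + 24) + 2 by omega, pow_add]; ring
    linarith
  have e : (2 : ℝ) ^ (ν + n + 27) * (P.K * P.N) * P.g ^ 2 * P.XV * (Real.log P.p / (P.p - 1)) =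
      (2 ^ (n + 26) * (P.K * P.N) * P.g) * (2 ^ (ν + 1) * P.g * P.XV * (Real.log P.p / (P.p - 1))) := by
    rw [show ν + n + 27 = (n + 26) + (ν + 1) by omega, pow_add]; ring
  rw [e]
  calc (2 : ℝ) ^ (ν + 1) * 2 ^ P.SdN * P.g * P.XV * (Real.log P.p / (P.p - 1))
      = 2 ^ P.SdN * (2 ^ (ν + 1) * P.g * P.XV * (Real.log P.p / (P.p - 1))) := by ring
    _ ≤ (2 ^ (n + 26) * (P.K * P.N) * P.g) * (2 ^ (ν + 1) * P.g * P.XV * (Real.log P.p / (P.p - 1))) :=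
        mul_le_mul_of_nonneg_right h2 h0

/-- `CondFloorV ν ≤ CondFloorN ν` under `N_q = K` (the true depth is deeper). [folklore] -/
theorem CondFloorV_le_CondFloorN (hNq : P.Nq = P.K) (ν : ℕ) : P.CondFloorV ν ≤ P.CondFloorN ν := by
  unfold CondFloorN PadicG3Par.CondFloorV
  obtain ⟨_, hκ0⟩ := P.kappa_le_one
  have hg : 0 ≤ P.g := by linarith [P.one_le_g]
  have hX : (0 : ℝ) ≤ P.XV := by positivity
  have hS : (2 : ℝ) ^ P.SdG ≤ 2 ^ P.SdN := pow_le_pow_right₀ (by norm_num) (P.SdG_le_SdN hNq)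
  have h0 : 0 ≤ (2 : ℝ) ^ (ν + 1) * P.g * P.XV * (Real.log P.p / (P.p - 1)) := by positivity
  calc (2 : ℝ) ^ (ν + 1) * 2 ^ P.SdG * P.g * P.XV * (Real.log P.p / (P.p - 1))
      = 2 ^ P.SdG * (2 ^ (ν + 1) * P.g * P.XV * (Real.log P.p / (P.p - 1))) := by ring
    _ ≤ 2 ^ P.SdN * (2 ^ (ν + 1) * P.g * P.XV * (Real.log P.p / (P.p - 1))) :=
        mul_le_mul_of_nonneg_right hS h0
    _ = 2 ^ (ν + 1) * 2 ^ P.SdN * P.g * P.XV * (Real.log P.p / (P.p - 1)) := by ring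

/-- `CondFloorN ν ≤ CondFloorN n` for `ν ≤ n`. [folklore] -/
theorem CondFloorN_mono {ν : ℕ} (hν : ν ≤ n) : P.CondFloorN ν ≤ P.CondFloorN n := by
  unfold CondFloorN
  obtain ⟨_, hκ0⟩ := P.kappa_le_one
  have hg : 0 ≤ P.g := by linarith [P.one_le_g]
  have hX : (0 : ℝ) ≤ P.XV := by positivity
  have h0 : 0 ≤ (2 : ℝ) ^ P.SdN * P.g * P.XV * (Real.log P.p / (P.p - 1)) := by positivity
  have h1 : (2 : ℝ) ^ (ν + 1) ≤ 2 ^ (n + 1) := pow_le_pow_right₀ (by norm_num) (by omega)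
  calc (2 : ℝ) ^ (ν + 1) * 2 ^ P.SdN * P.g * P.XV * (Real.log P.p / (P.p - 1))
      = 2 ^ (ν + 1) * (2 ^ P.SdN * P.g * P.XV * (Real.log P.p / (P.p - 1))) := by ring
    _ ≤ 2 ^ (n + 1) * (2 ^ P.SdN * P.g * P.XV * (Real.log P.p / (P.p - 1))) :=
        mul_le_mul_of_nonneg_right h1 h0
    _ = 2 ^ (n + 1) * 2 ^ P.SdN * P.g * P.XV * (Real.log P.p / (P.p - 1)) := by ring

end PadicG3ParN

end Summit.ABC.StewartYu
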